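import Summits.BirchSwinnertonDyer.BirchSwinnertonDyer.Theses.FrozenTwin

/-!
# Birth skeleton (BC3) for crux `FrozenTwinBound` — route `FrozenTwin`, item stmt-BirchSwinnertonDyer-17173

Crux (fixed, the route's decl `Summit.BirchSwinnertonDyer.BirchSwinnertonDyer.Theses.FrozenTwin.FrozenTwinBound`):
for every admissible frozen-twin datum `(E = V, p, K, N⁺N⁻, B = (a,b)_ℚ, O, RI, φ, (ψ, I), σ, dlog)` and every
`k ≤ p − 2`: `p ∤ M_k := Σ_{𝔞 ∈ Cl_K} C(dlog 𝔞, k)·φ(x_𝔞)` ⇒ `corank_{ℤ_p} Sel_{p^∞}(E/ℚ) ≤ k`.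

The line (the route's own intended proof, TWO-LAYER PLAN of the route header) factors through the ORDER-`p`
CLASS-GROUP TWIST of the Gross period, `S_χ := Σ_{𝔞} χ(𝔞) φ(x_𝔞) ∈ ℤ[ζ_p]` with `χ(𝔞) = ζ^{dlog 𝔞}`
(`ζ` a primitive `p`-th root of unity; `χ` is the order-`p` character of `Cl_K` through its cyclic
`p`-Sylow `⟨σ⟩`), and its `𝔓`-adic valuation at `𝔓 = (ζ − 1)`, the prime of `ℚ(ζ_p)` above `p`:

* `stub_momentValuation` (card P1; elementary cyclotomic arithmetic, size M): since
  `ζ^d = Σ_j C(d,j)(ζ−1)^j`, `S_χ = Σ_j (ζ−1)^j M_j`; as `v_𝔓(p) = p − 1` and `v_𝔓(ζ−1) = 1`,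
  `p ∤ M_k` with `k ≤ p − 2` forces `v_𝔓(S_χ) = min{j : p ∤ M_j} ≤ k`, i.e. `S_χ ∉ 𝔓^{k+1}`.
  Stated for an arbitrary finite index set `X`, exponent map `d` and integer weights `f`.
* `stub_twistedPeriodSelmerBound` (cards K2 + P2 + P3; the load-bearing, literature-adjacent stub, size L/XL):
  for the admissible datum, `v_𝔓(S_χ) ≤ k` ⇒ `Sel_p(E/ℚ)` is finite of order `≤ p^k`
  (`s⁺ := dim_{𝔽_p} Sel_p(E/ℚ) ≤ v_𝔓(S_χ)`). Intended proof = FREEZING (Mazur–Rubin 2007 Prop 1.3: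
  `Sel_𝔓(A_χ/K) = Sel_p(E/K) = Sel_p(E/ℚ) ⊕ Sel_p(E^{D_K}/ℚ)` under the side conditions) + DOUBLING
  (Cassels–Tate–Flach form on `Ш(A_χ/K)[𝔓^∞]`, anti-invariant shadow ⇒ `length ≥ 2·max(s⁺,s⁻)`; the
  linear algebra is `Literature.Barriers.BirchSwinnertonDyer.AnticyclotomicHeightDegeneracy`) + the RANK-0
  LENGTH BOUND `length_𝒪 Ш(A_χ/K)[𝔓^∞] ≤ 2·v_𝔓(S_χ)` (Gross–Waldspurger nonvanishing `S_χ ≠ 0 ⇒ L(E/K,χ,1) ≠ 0`;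
  Bertolini–Darmon 2005 / Longo–Vigni arXiv:0806.4267 / Nekovář doi:10.4153/cjm-2011-077-6 / Kim2024 Thm 5.23).
  The twin `A_χ`, its `Ш` and the Cassels–Tate–Flach form are not tree notions (route DEFINITION REQUESTS), so
  these three layer-2 children ride inside this one stub, typed on the tree notion `WeierstrassCurve.selmerGroup`.
* `stub_selmerCorank_le_of_card_selmerGroup` (known, Kummer theory; size M in the tree's cohomological model):
  `Sel_p(E/ℚ) ↠ Sel_{p^∞}(E/ℚ)[p]` (long exact sequence of `0 → E[p] → E[p^∞] → E[p^∞] → 0`, `E(ℚ̄)` divisible,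
  and the local conditions "dies in `H¹(ℚ_v, E)`" are compatible), hence
  `corank_{ℤ_p} Sel_{p^∞} = dim Sel_{p^∞}[p] − dim Sel_{p^∞}/p ≤ dim_{𝔽_p} Sel_{p^∞}[p] ≤ log_p #Sel_p(E/ℚ) ≤ k`
  (Greenberg LNM 1716 §1–2; Silverman AEC X.4.2; the tree's `Literature.NumberTheory.EllipticCurves.zpCorank`).

`FrozenTwinBound_of_stubs` composes the three statements (real proof: instantiate `L := CyclotomicField p ℚ`,
`ζ := (zeta_spec p ℚ L).toInteger`), and `FrozenTwinBound_of : FrozenTwinBound` is the closed registrar-shape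
theorem `FrozenTwinBound_of_stubs stub₁ stub₂ stub₃` concluding the crux BY NAME.

`sorry` occurs ONLY in the three `stub_*` theorems (three sorries = three stubs); nowhere else.
-/

namespace Summit.BirchSwinnertonDyer.BirchSwinnertonDyer.Cruxes.FrozenTwinBound.Birth

open scoped BigOperators

/-- STUB 1 (card P1, elementary; size M). MOMENTS ⇒ VALUATION. For a prime `p`, a finite index set `X`,
exponents `d : X → ℕ`, weights `f : X → ℤ` and `k ≤ p − 2`: if `p ∤ M_k := Σ_x C(d x, k)·f x` then, for every
primitive `p`-th root of unity `ζ` in the ring of integers of the `p`-th cyclotomic field,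
`S := Σ_x ζ^{d x}·f x ∉ (ζ − 1)^{k+1}`, i.e. `v_𝔓(S) ≤ k` (`S = Σ_j (ζ−1)^j M_j`, `v_𝔓(ζ−1) = 1`,
`v_𝔓(p) = p − 1 > k`). Why plausibly true: it is a three-line valuation computation (Washington, Cyclotomic
Fields, Lemma 1.4: `(p) = (1−ζ)^{p−1}`); Mathlib: `IsPrimitiveRoot.zeta_sub_one_prime'`,
`IsPrimitiveRoot.toInteger_sub_one_dvd_prime'`, `IsCyclotomicExtension.Rat.absNorm_span_zeta_sub_one`. -/
theorem stub_momentValuation :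
    ∀ (p : ℕ) [Fact p.Prime] (X : Type) [Fintype X] (d : X → ℕ) (f : X → ℤ) (k : ℕ),
      k + 2 ≤ p → ¬ (p : ℤ) ∣ ∑ x : X, ((d x).choose k : ℤ) * f x →
      ∀ (L : Type) [Field L] [CharZero L] [IsCyclotomicExtension {p} ℚ L]
        (ζ : NumberField.RingOfIntegers L), IsPrimitiveRoot ζ p →
        (∑ x : X, ζ ^ (d x) * ((f x : ℤ) : NumberField.RingOfIntegers L)) ∉
          (Ideal.span {ζ - 1} : Ideal (NumberField.RingOfIntegers L)) ^ (k + 1) := by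
  sorry

/-- STUB 2 (cards K2 + P2 + P3; LOAD-BEARING, literature-adjacent; size L–XL). TWISTED PERIOD ⇒ p-SELMER BOUND.
For every admissible frozen-twin datum (the crux's hypotheses verbatim) and every `k`: if the order-`p`
class-group twist of the Gross period `S_χ = Σ_𝔞 ζ^{dlog 𝔞} φ(x_𝔞)` has `v_𝔓(S_χ) ≤ k` (`S_χ ∉ (ζ−1)^{k+1}`),
then `Sel_p(E/ℚ)` is finite of order `≤ p^k`. Intended proof: freezing (MR2007 Prop 1.3) + doubling
(Cassels–Tate–Flach, anti-invariant shadow: `length ≥ 2·max(s⁺,s⁻)`) + rank-0 length bound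
`length_𝒪 Ш(A_χ/K)[𝔓^∞] ≤ 2·v_𝔓(S_χ)` (Gross–Waldspurger; BD2005 / Longo–Vigni / Nekovář / Kim2024 5.23).
Why it might fail: the rank-0 `𝔓`-part bound at `𝔓 ∣ p = ord χ ∣ h_K` is unprinted (route header). -/
theorem stub_twistedPeriodSelmerBound :
    ∀ (V : WeierstrassCurve ℚ) [V.IsElliptic] [V.IsGloballyMinimal] (p : ℕ) [Fact p.Prime] (Nplus Nminus m : ℕ) (a b : ℚ) (O : Subring (QuaternionAlgebra ℚ a 0 b)) (K : Type) [Field K] [NumberField K] (ψ : K →ₐ[ℚ] QuaternionAlgebra ℚ a 0 b) (I : Submodule ℤ (QuaternionAlgebra ℚ a 0 b)) (φ : Submodule ℤ (QuaternionAlgebra ℚ a 0 b) → ℤ) (rep : ClassGroup (NumberField.RingOfIntegers K) → nonZeroDivisors (Ideal (NumberField.RingOfIntegers K))) (RI : Set (Submodule ℤ (QuaternionAlgebra ℚ a 0 b))) (σ : ClassGroup (NumberField.RingOfIntegers K)) (dlog : ClassGroup (NumberField.RingOfIntegers K) → ℕ), ((5 ≤ p ∧ V.HasGoodReductionAtPrime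 p ∧ ¬ (p : ℤ) ∣ V.frobeniusTrace p ∧ V.HasSurjectiveModNGaloisRep p ∧ (∀ q : ℕ, q.Prime → q ∣ V.conductorNorm ℤ → ¬ (p : ℤ) ∣ (q : ℤ) ^ 2 - 1) ∧ (∀ (q : ℕ) (_ : Fact q.Prime), V.HasMultiplicativeReductionAtPrime q → ¬ (p : ℤ) ∣ padicValRat q V.j)) ∧ (Module.finrank ℚ K = 2 ∧ NumberField.IsTotallyComplex K ∧ NumberField.discr K < -4 ∧ Int.gcd (NumberField.discr K) (V.conductorNorm ℤ * p) = 1) ∧ (V.conductorNorm ℤ = Nplus * Nminus ∧ Nat.Coprime Nplus Nminus ∧ Squarefree Nminus ∧ Odd Nminus.primeFactors.card ∧ (∀ q : ℕ, q.Prime → q ∣ Nplus → ((Ideal.span {(q : ℤ)}).primesOver (NumberField.RingOfIntegers K)).ncard = 2) ∧ (∀ q : ℕ, q.Prime → q ∣ Nminus → ((Ideal.span {(q : ℤ)}).primesOver (NumberField.RingOfIntegers K)).ncard = 1)) ∧ (a < 0 ∧ b < 0 ∧ (∀ (q : ℕ) [Fact q.Prime], (∀ x : QuaternionAlgebra ℚ_[q]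 (a : ℚ_[q]) 0 (b : ℚ_[q]), x ≠ 0 → IsUnit x) ↔ q ∣ Nminus)) ∧ (∃ O₁ O₂ : Subring (QuaternionAlgebra ℚ a 0 b), (∀ S : Subring (QuaternionAlgebra ℚ a 0 b), (S = O₁ ∨ S = O₂) → (S.toAddSubgroup.FG ∧ (∀ d : QuaternionAlgebra ℚ a 0 b, ∃ n : ℤ, n ≠ 0 ∧ n • d ∈ S) ∧ ∀ S' : Subring (QuaternionAlgebra ℚ a 0 b), S'.toAddSubgroup.FG → S ≤ S' → S' = S)) ∧ O = O₁ ⊓ O₂ ∧ O.toAddSubgroup.relIndex O₁.toAddSubgroup = Nplus) ∧ (∀ J : Submodule ℤ (QuaternionAlgebra ℚ a 0 b), J ∈ RI ↔ (J.FG ∧ (∀ d : QuaternionAlgebra ℚ a 0 b, ∃ n : ℤ, n ≠ 0 ∧ n • d ∈ J) ∧ (∀ x : QuaternionAlgebra ℚ a 0 b, (∀ y ∈ J, y * x ∈ J) ↔ x ∈ O) ∧ (∃ J' : Submodule ℤ (QuaternionAlgebra ℚ a 0 b), (∀ x : QuaternionAlgebra ℚ a 0 b, x ∈ J * J' ↔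 ∀ y ∈ J, x * y ∈ J) ∧ (∀ x : QuaternionAlgebra ℚ a 0 b, x ∈ J' * J ↔ x ∈ O)))) ∧ ((∀ J ∈ RI, ∀ β : QuaternionAlgebra ℚ a 0 b, IsUnit β → φ (J.map (AddMonoidHom.mulLeft β).toIntLinearMap) = φ J) ∧ (∀ q : ℕ, q.Prime → ¬ q ∣ V.conductorNorm ℤ → ∀ J ∈ RI, ∑ᶠ J' ∈ {J' : Submodule ℤ (QuaternionAlgebra ℚ a 0 b) | J' ≤ J ∧ J'.toAddSubgroup.relIndex J.toAddSubgroup = q ^ 2 ∧ ∀ y ∈ J', ∀ x ∈ O, y * x ∈ J'}, φ J' = (V.frobeniusTrace q : ℤ) * φ J) ∧ (∃ J ∈ RI, ¬ (p : ℤ) ∣ φ J)) ∧ (I ∈ RI ∧ (∀ x : NumberField.RingOfIntegers K, ∀ y ∈ I, ψ (x : K) * y ∈ I) ∧ (∀ x : K, (∀ y ∈ I, ψ x * y ∈ I) → ∃ z : NumberField.RingOfIntegers K, (z : K) = x) ∧ (∀ 𝔞 : ClassGroup (NumberField.RingOfIntegers K), ClassGroup.mk0 (rep 𝔞) = 𝔞)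 ∧ (∀ 𝔞 : ClassGroup (NumberField.RingOfIntegers K), Submodule.span ℤ ((fun x : NumberField.RingOfIntegers K => ψ (x : K)) '' ((rep 𝔞 : nonZeroDivisors (Ideal (NumberField.RingOfIntegers K))) : Ideal (NumberField.RingOfIntegers K))) * I ∈ RI)) ∧ (1 ≤ m ∧ orderOf σ = p ^ m ∧ ¬ p ^ (m + 1) ∣ Fintype.card (ClassGroup (NumberField.RingOfIntegers K)) ∧ (∀ 𝔞 : ClassGroup (NumberField.RingOfIntegers K), dlog 𝔞 < p ^ m ∧ Nat.Coprime (orderOf (𝔞 * (σ ^ dlog 𝔞)⁻¹)) p))) →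
      ∀ (k : ℕ) (L : Type) [Field L] [CharZero L] [IsCyclotomicExtension {p} ℚ L]
        (ζ : NumberField.RingOfIntegers L), IsPrimitiveRoot ζ p →
        (∑ 𝔞 : ClassGroup (NumberField.RingOfIntegers K),
            ζ ^ (dlog 𝔞) * ((φ (Submodule.span ℤ ((fun x : NumberField.RingOfIntegers K => ψ (x : K)) '' ((rep 𝔞 : nonZeroDivisors (Ideal (NumberField.RingOfIntegers K))) : Ideal (NumberField.RingOfIntegers K))) * I) : ℤ) : NumberField.RingOfIntegers L)) ∉
          (Ideal.span {ζ - 1} : Ideal (NumberField.RingOfIntegers L)) ^ (k + 1) →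
        Finite ↥(V.selmerGroup (p : ℤ)) ∧ Nat.card ↥(V.selmerGroup (p : ℤ)) ≤ p ^ k := by
  sorry

/-- STUB 3 (known; Kummer theory in the tree's cohomological model; size M). CARD OF p-SELMER ⇒ CORANK.
`Sel_p(E/ℚ) ↠ Sel_{p^∞}(E/ℚ)[p]`, so `corank_{ℤ_p} Sel_{p^∞}(E/ℚ) ≤ dim_{𝔽_p} Sel_{p^∞}[p] ≤ log_p #Sel_p(E/ℚ)`.
Greenberg LNM 1716 §§1–2; Silverman AEC X.4.2; `Literature.NumberTheory.EllipticCurves.zpCorank` (ℕ-subtraction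
only helps). -/
theorem stub_selmerCorank_le_of_card_selmerGroup :
    ∀ (V : WeierstrassCurve ℚ) [V.IsElliptic] (p : ℕ) [Fact p.Prime] (k : ℕ),
      Finite ↥(V.selmerGroup (p : ℤ)) → Nat.card ↥(V.selmerGroup (p : ℤ)) ≤ p ^ k →
      V.selmerCorank p ≤ k := by
  sorry

/-! ## Assembly (sorry-free) -/

/-- ASSEMBLY (kernel-checked, real proof): the three stub STATEMENTS (hypotheses `h1 h2 h3`, verbatim the
types of `stub_momentValuation`, `stub_twistedPeriodSelmerBound`, `stub_selmerCorank_le_of_card_selmerGroup`)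
imply the crux statement (verbatim the body of `FrozenTwin.FrozenTwinBound`; `FrozenTwinBound_of` below concludes
it BY NAME). Given the datum and `p ∤ M_k` (`k + 2 ≤ p`), `h1` (on the finite set `Cl_K` with
`d := dlog`, `f := 𝔞 ↦ φ(x_𝔞)`, in `L := CyclotomicField p ℚ` at Mathlib's `zeta`) gives `v_𝔓(S_χ) ≤ k`;
`h2` turns that into `#Sel_p(E/ℚ) ≤ p^k` (finite); `h3` gives `corank_{ℤ_p} Sel_{p^∞}(E/ℚ) ≤ k`. -/
theorem FrozenTwinBound_of_stubs
    (h1 : ∀ (p : ℕ) [Fact p.Prime] (X : Type) [Fintype X] (d : X → ℕ) (f : X → ℤ) (k : ℕ),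
      k + 2 ≤ p → ¬ (p : ℤ) ∣ ∑ x : X, ((d x).choose k : ℤ) * f x →
      ∀ (L : Type) [Field L] [CharZero L] [IsCyclotomicExtension {p} ℚ L]
        (ζ : NumberField.RingOfIntegers L), IsPrimitiveRoot ζ p →
        (∑ x : X, ζ ^ (d x) * ((f x : ℤ) : NumberField.RingOfIntegers L)) ∉
          (Ideal.span {ζ - 1} : Ideal (NumberField.RingOfIntegers L)) ^ (k + 1))
    (h2 : ∀ (V : WeierstrassCurve ℚ) [V.IsElliptic] [V.IsGloballyMinimal] (p : ℕ) [Fact p.Prime] (Nplus Nminus m : ℕ) (a b : ℚ) (O : Subring (QuaternionAlgebra ℚ a 0 b)) (K : Type) [Field K] [NumberField K] (ψ : K →ₐ[ℚ] QuaternionAlgebra ℚ a 0 b) (I : Submodule ℤ (QuaternionAlgebra ℚ a 0 b)) (φ : Submodule ℤ (QuaternionAlgebra ℚ a 0 b) → ℤ) (rep : ClassGroup (NumberField.RingOfIntegers K) → nonZeroDivisors (Ideal (NumberField.RingOfIntegers K))) (RI : Set (Submodule ℤ (QuaternionAlgebra ℚ a 0 b))) (σ : ClassGroup (NumberField.RingOfIntegers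 K)) (dlog : ClassGroup (NumberField.RingOfIntegers K) → ℕ), ((5 ≤ p ∧ V.HasGoodReductionAtPrime p ∧ ¬ (p : ℤ) ∣ V.frobeniusTrace p ∧ V.HasSurjectiveModNGaloisRep p ∧ (∀ q : ℕ, q.Prime → q ∣ V.conductorNorm ℤ → ¬ (p : ℤ) ∣ (q : ℤ) ^ 2 - 1) ∧ (∀ (q : ℕ) (_ : Fact q.Prime), V.HasMultiplicativeReductionAtPrime q → ¬ (p : ℤ) ∣ padicValRat q V.j)) ∧ (Module.finrank ℚ K = 2 ∧ NumberField.IsTotallyComplex K ∧ NumberField.discr K < -4 ∧ Int.gcd (NumberField.discr K) (V.conductorNorm ℤ * p) = 1) ∧ (V.conductorNorm ℤ = Nplus * Nminus ∧ Nat.Coprime Nplus Nminus ∧ Squarefree Nminus ∧ Odd Nminus.primeFactors.card ∧ (∀ q : ℕ, q.Prime → q ∣ Nplus → ((Ideal.span {(q : ℤ)}).primesOver (NumberField.RingOfIntegers K)).ncard = 2) ∧ (∀ q : ℕ, q.Prime → q ∣ Nminus → ((Ideal.span {(q : ℤ)}).primesOver (NumberField.RingOfIntegers K)).ncard = 1))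 ∧ (a < 0 ∧ b < 0 ∧ (∀ (q : ℕ) [Fact q.Prime], (∀ x : QuaternionAlgebra ℚ_[q] (a : ℚ_[q]) 0 (b : ℚ_[q]), x ≠ 0 → IsUnit x) ↔ q ∣ Nminus)) ∧ (∃ O₁ O₂ : Subring (QuaternionAlgebra ℚ a 0 b), (∀ S : Subring (QuaternionAlgebra ℚ a 0 b), (S = O₁ ∨ S = O₂) → (S.toAddSubgroup.FG ∧ (∀ d : QuaternionAlgebra ℚ a 0 b, ∃ n : ℤ, n ≠ 0 ∧ n • d ∈ S) ∧ ∀ S' : Subring (QuaternionAlgebra ℚ a 0 b), S'.toAddSubgroup.FG → S ≤ S' → S' = S)) ∧ O = O₁ ⊓ O₂ ∧ O.toAddSubgroup.relIndex O₁.toAddSubgroup = Nplus) ∧ (∀ J : Submodule ℤ (QuaternionAlgebra ℚ a 0 b), J ∈ RI ↔ (J.FG ∧ (∀ d : QuaternionAlgebra ℚ a 0 b, ∃ n : ℤ, n ≠ 0 ∧ n • d ∈ J) ∧ (∀ x : QuaternionAlgebra ℚ a 0 b, (∀ y ∈ J, y * x ∈ J) ↔ x ∈ O) ∧ (∃ J'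 : Submodule ℤ (QuaternionAlgebra ℚ a 0 b), (∀ x : QuaternionAlgebra ℚ a 0 b, x ∈ J * J' ↔ ∀ y ∈ J, x * y ∈ J) ∧ (∀ x : QuaternionAlgebra ℚ a 0 b, x ∈ J' * J ↔ x ∈ O)))) ∧ ((∀ J ∈ RI, ∀ β : QuaternionAlgebra ℚ a 0 b, IsUnit β → φ (J.map (AddMonoidHom.mulLeft β).toIntLinearMap) = φ J) ∧ (∀ q : ℕ, q.Prime → ¬ q ∣ V.conductorNorm ℤ → ∀ J ∈ RI, ∑ᶠ J' ∈ {J' : Submodule ℤ (QuaternionAlgebra ℚ a 0 b) | J' ≤ J ∧ J'.toAddSubgroup.relIndex J.toAddSubgroup = q ^ 2 ∧ ∀ y ∈ J', ∀ x ∈ O, y * x ∈ J'}, φ J' = (V.frobeniusTrace q : ℤ) * φ J) ∧ (∃ J ∈ RI, ¬ (p : ℤ) ∣ φ J)) ∧ (I ∈ RI ∧ (∀ x : NumberField.RingOfIntegers K, ∀ y ∈ I, ψ (x : K) * y ∈ I) ∧ (∀ x : K, (∀ y ∈ I, ψ x * y ∈ I) → ∃ z : NumberField.RingOfIntegers K,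 (z : K) = x) ∧ (∀ 𝔞 : ClassGroup (NumberField.RingOfIntegers K), ClassGroup.mk0 (rep 𝔞) = 𝔞) ∧ (∀ 𝔞 : ClassGroup (NumberField.RingOfIntegers K), Submodule.span ℤ ((fun x : NumberField.RingOfIntegers K => ψ (x : K)) '' ((rep 𝔞 : nonZeroDivisors (Ideal (NumberField.RingOfIntegers K))) : Ideal (NumberField.RingOfIntegers K))) * I ∈ RI)) ∧ (1 ≤ m ∧ orderOf σ = p ^ m ∧ ¬ p ^ (m + 1) ∣ Fintype.card (ClassGroup (NumberField.RingOfIntegers K)) ∧ (∀ 𝔞 : ClassGroup (NumberField.RingOfIntegers K), dlog 𝔞 < p ^ m ∧ Nat.Coprime (orderOf (𝔞 * (σ ^ dlog 𝔞)⁻¹)) p))) →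
      ∀ (k : ℕ) (L : Type) [Field L] [CharZero L] [IsCyclotomicExtension {p} ℚ L]
        (ζ : NumberField.RingOfIntegers L), IsPrimitiveRoot ζ p →
        (∑ 𝔞 : ClassGroup (NumberField.RingOfIntegers K),
            ζ ^ (dlog 𝔞) * ((φ (Submodule.span ℤ ((fun x : NumberField.RingOfIntegers K => ψ (x : K)) '' ((rep 𝔞 : nonZeroDivisors (Ideal (NumberField.RingOfIntegers K))) : Ideal (NumberField.RingOfIntegers K))) * I) : ℤ) : NumberField.RingOfIntegers L)) ∉
          (Ideal.span {ζ - 1} : Ideal (NumberField.RingOfIntegers L)) ^ (k + 1) →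
        Finite ↥(V.selmerGroup (p : ℤ)) ∧ Nat.card ↥(V.selmerGroup (p : ℤ)) ≤ p ^ k)
    (h3 : ∀ (V : WeierstrassCurve ℚ) [V.IsElliptic] (p : ℕ) [Fact p.Prime] (k : ℕ),
      Finite ↥(V.selmerGroup (p : ℤ)) → Nat.card ↥(V.selmerGroup (p : ℤ)) ≤ p ^ k →
      V.selmerCorank p ≤ k) :
    -- the body of `FrozenTwin.FrozenTwinBound`, verbatim (the closed theorem `FrozenTwinBound_of` below
    -- restates it BY NAME; kept unfolded here so that the registrar sees exactly one theorem concluding the crux)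
    ∀ (V : WeierstrassCurve ℚ) [V.IsElliptic] [V.IsGloballyMinimal] (p : ℕ) [Fact p.Prime] (Nplus Nminus m : ℕ) (a b : ℚ) (O : Subring (QuaternionAlgebra ℚ a 0 b)) (K : Type) [Field K] [NumberField K] (ψ : K →ₐ[ℚ] QuaternionAlgebra ℚ a 0 b) (I : Submodule ℤ (QuaternionAlgebra ℚ a 0 b)) (φ : Submodule ℤ (QuaternionAlgebra ℚ a 0 b) → ℤ) (rep : ClassGroup (NumberField.RingOfIntegers K) → nonZeroDivisors (Ideal (NumberField.RingOfIntegers K))) (RI : Set (Submodule ℤ (QuaternionAlgebra ℚ a 0 b))) (σ : ClassGroup (NumberField.RingOfIntegers K)) (dlog : ClassGroup (NumberField.RingOfIntegers K) → ℕ), ((5 ≤ p ∧ V.HasGoodReductionAtPrime p ∧ ¬ (p : ℤ) ∣ V.frobeniusTrace p ∧ V.HasSurjectiveModNGaloisRep p ∧ (∀ q : ℕ, q.Prime → q ∣ V.conductorNorm ℤ → ¬ (p : ℤ) ∣ (q : ℤ) ^ 2 - 1) ∧ (∀ (q : ℕ) (_ : Fact q.Prime), V.HasMultiplicativeReductionAtPrime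 q → ¬ (p : ℤ) ∣ padicValRat q V.j)) ∧ (Module.finrank ℚ K = 2 ∧ NumberField.IsTotallyComplex K ∧ NumberField.discr K < -4 ∧ Int.gcd (NumberField.discr K) (V.conductorNorm ℤ * p) = 1) ∧ (V.conductorNorm ℤ = Nplus * Nminus ∧ Nat.Coprime Nplus Nminus ∧ Squarefree Nminus ∧ Odd Nminus.primeFactors.card ∧ (∀ q : ℕ, q.Prime → q ∣ Nplus → ((Ideal.span {(q : ℤ)}).primesOver (NumberField.RingOfIntegers K)).ncard = 2) ∧ (∀ q : ℕ, q.Prime → q ∣ Nminus → ((Ideal.span {(q : ℤ)}).primesOver (NumberField.RingOfIntegers K)).ncard = 1)) ∧ (a < 0 ∧ b < 0 ∧ (∀ (q : ℕ) [Fact q.Prime], (∀ x : QuaternionAlgebra ℚ_[q] (a : ℚ_[q]) 0 (b : ℚ_[q]), x ≠ 0 → IsUnit x) ↔ q ∣ Nminus)) ∧ (∃ O₁ O₂ : Subring (QuaternionAlgebra ℚ a 0 b), (∀ S : Subring (QuaternionAlgebra ℚ a 0 b), (S = O₁ ∨ S = O₂) → (S.toAddSubgroup.FG ∧ (∀ d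 : QuaternionAlgebra ℚ a 0 b, ∃ n : ℤ, n ≠ 0 ∧ n • d ∈ S) ∧ ∀ S' : Subring (QuaternionAlgebra ℚ a 0 b), S'.toAddSubgroup.FG → S ≤ S' → S' = S)) ∧ O = O₁ ⊓ O₂ ∧ O.toAddSubgroup.relIndex O₁.toAddSubgroup = Nplus) ∧ (∀ J : Submodule ℤ (QuaternionAlgebra ℚ a 0 b), J ∈ RI ↔ (J.FG ∧ (∀ d : QuaternionAlgebra ℚ a 0 b, ∃ n : ℤ, n ≠ 0 ∧ n • d ∈ J) ∧ (∀ x : QuaternionAlgebra ℚ a 0 b, (∀ y ∈ J, y * x ∈ J) ↔ x ∈ O) ∧ (∃ J' : Submodule ℤ (QuaternionAlgebra ℚ a 0 b), (∀ x : QuaternionAlgebra ℚ a 0 b, x ∈ J * J' ↔ ∀ y ∈ J, x * y ∈ J) ∧ (∀ x : QuaternionAlgebra ℚ a 0 b, x ∈ J' * J ↔ x ∈ O)))) ∧ ((∀ J ∈ RI, ∀ β : QuaternionAlgebra ℚ a 0 b, IsUnit β → φ (J.map (AddMonoidHom.mulLeft β).toIntLinearMap) = φ J) ∧ (∀ q :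 ℕ, q.Prime → ¬ q ∣ V.conductorNorm ℤ → ∀ J ∈ RI, ∑ᶠ J' ∈ {J' : Submodule ℤ (QuaternionAlgebra ℚ a 0 b) | J' ≤ J ∧ J'.toAddSubgroup.relIndex J.toAddSubgroup = q ^ 2 ∧ ∀ y ∈ J', ∀ x ∈ O, y * x ∈ J'}, φ J' = (V.frobeniusTrace q : ℤ) * φ J) ∧ (∃ J ∈ RI, ¬ (p : ℤ) ∣ φ J)) ∧ (I ∈ RI ∧ (∀ x : NumberField.RingOfIntegers K, ∀ y ∈ I, ψ (x : K) * y ∈ I) ∧ (∀ x : K, (∀ y ∈ I, ψ x * y ∈ I) → ∃ z : NumberField.RingOfIntegers K, (z : K) = x) ∧ (∀ 𝔞 : ClassGroup (NumberField.RingOfIntegers K), ClassGroup.mk0 (rep 𝔞) = 𝔞) ∧ (∀ 𝔞 : ClassGroup (NumberField.RingOfIntegers K), Submodule.span ℤ ((fun x : NumberField.RingOfIntegers K => ψ (x : K)) '' ((rep 𝔞 : nonZeroDivisors (Ideal (NumberField.RingOfIntegers K))) : Ideal (NumberField.RingOfIntegers K))) * I ∈ RI)) ∧ (1 ≤ m ∧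 orderOf σ = p ^ m ∧ ¬ p ^ (m + 1) ∣ Fintype.card (ClassGroup (NumberField.RingOfIntegers K)) ∧ (∀ 𝔞 : ClassGroup (NumberField.RingOfIntegers K), dlog 𝔞 < p ^ m ∧ Nat.Coprime (orderOf (𝔞 * (σ ^ dlog 𝔞)⁻¹)) p))) → ∀ k : ℕ, k + 2 ≤ p → ¬ (p : ℤ) ∣ ∑ 𝔞 : ClassGroup (NumberField.RingOfIntegers K), ((dlog 𝔞).choose k : ℤ) * φ (Submodule.span ℤ ((fun x : NumberField.RingOfIntegers K => ψ (x : K)) '' ((rep 𝔞 : nonZeroDivisors (Ideal (NumberField.RingOfIntegers K))) : Ideal (NumberField.RingOfIntegers K))) * I) → V.selmerCorank p ≤ k := by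
  intro V _ _ p hp Nplus Nminus m a b O K _ _ ψ I φ rep RI σ dlog hH k hkp hndvd
  haveI : NeZero p := ⟨hp.out.ne_zero⟩
  -- the p-th cyclotomic field and Mathlib's chosen primitive p-th root of unity, as an integer
  haveI : IsCyclotomicExtension {p} ℚ (CyclotomicField p ℚ) :=
    CyclotomicField.isCyclotomicExtension p ℚ
  have hζ := (IsCyclotomicExtension.zeta_spec p ℚ (CyclotomicField p ℚ)).toInteger_isPrimitiveRoot
  have hval := h1 p (ClassGroup (NumberField.RingOfIntegers K)) dlog
    (fun 𝔞 => φ (Submodule.span ℤ ((fun x : NumberField.RingOfIntegers K => ψ (x : K)) '' ((rep 𝔞 : nonZeroDivisors (Ideal (NumberField.RingOfIntegers K))) : Ideal (NumberField.RingOfIntegers K))) * I)) k hkp hndvd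
    (CyclotomicField p ℚ) _ hζ
  obtain ⟨hfin, hcard⟩ := h2 V p Nplus Nminus m a b O K ψ I φ rep RI σ dlog hH k
    (CyclotomicField p ℚ) _ hζ hval
  exact h3 V p k hfin hcard

/-- THE SKELETON THEOREM (registrar shape). The crux
`Summit.BirchSwinnertonDyer.BirchSwinnertonDyer.Theses.FrozenTwin.FrozenTwinBound`, concluded BY NAME from the
three declared stubs through the sorry-free assembly `FrozenTwinBound_of_stubs`; the only `sorry`s in its
closure are `stub_momentValuation`, `stub_twistedPeriodSelmerBound`, `stub_selmerCorank_le_of_card_selmerGroup`. -/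
theorem FrozenTwinBound_of :
    Summit.BirchSwinnertonDyer.BirchSwinnertonDyer.Theses.FrozenTwin.FrozenTwinBound :=
  FrozenTwinBound_of_stubs @stub_momentValuation @stub_twistedPeriodSelmerBound
    @stub_selmerCorank_le_of_card_selmerGroup

end Summit.BirchSwinnertonDyer.BirchSwinnertonDyer.Cruxes.FrozenTwinBound.Birth
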